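import Literature.Analysis.ODE.ElementaryFieldVariationalCertificate
import Literature.Analysis.ODE.MeanValueEnclosureCertificate
import HarnessLib

/-!
# Mean-value-form enclosure certificate for one `C¹` step of an elementary field

Trunk T-ANA (Analysis/ODE); namespace `Literature.Analysis.ODE`.

`MeanValueEnclosureCertificate.lean` is Moore's MEAN VALUE EXTENSION (1979 §4.3 eq. (4.19))
`f(X) ⊆ f(m) + ∑ᵢ DᵢF(X)(Xᵢ − mᵢ)` applied to the time-`h` flow map `f = φ(h, ·)` of a
POLYNOMIAL field: `DᵢF(W)` = the columns of the Jacobian end box `J1 ⊇ D_xφ(h, [W])` of the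
polynomial `C¹` step certificate, `f(m)` = the end box of a point Taylor certificate from the
centre — the evaluation step of a `C¹`-Lohner integrator without coordinate change
(Zgliczyński 2002 §3: `φ(h,[x]) ⊂ Φ(h, m) + ∂Φ/∂x(h,[x])([x] − m)`; Mrozek–Zgliczyński 2000
Theorem 7.5).  `ElementaryFieldVariationalCertificate.lean` now certifies `J1` for ELEMENTARY
(code-list) fields `+ − × ^ exp log sin cos ⁻¹ / √` (`EVarStepCert.hasFDerivWithinAt_flow_step`,
symbolic Lie–Taylor coefficient code lists differentiated line by line), and
`ElementaryFieldEnclosureCertificate.lean` the point Taylor enclosure (`EStepCert`).  This file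
is the glue, parallel to the polynomial one decl by decl:

* `EMVStepCert n` = an `EVarStepCert n` (field code lists, order, step, `W`, a-priori boxes `S`,
  `VV`, precision parameters) plus a rational `center`, `centerOrder`, `centerApriori`;
  `pointCert : EStepCert n` (the point certificate from the centre, same code lists, step and
  precision); the Boolean `check` (the `C¹` check, `posBox S`, `m ∈ W`, the point check) with
  `check_spec`; `mvEndBox = pointCert.endBox + J1 · (W − m)`; `meetEndBox = mvEndBox ∩ endBox`.
* `EMVStepCert.meanValue` — THE MEAN VALUE FORM OF THE FLOW of an elementary field: if `check`
  accepts, then for every `x ∈ W` and every solution `z` from `x` on `[0, h]` there are a solution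
  `z_c` from the centre and a real matrix `M ∈ J1` with `z(h) = z_c(h) + M (x − m)`.
* `EMVStepCert.sound` — `z(h) ∈ mvEndBox` and `z(h) ∈ endBox`; `mem_meetEndBox`;
  `exists_of_check` (and `EVarStepCert.mem_dom (check_spec hc).1`: no solution from `W` leaves
  the natural domain of the code lists during the step).
* `emvStepVerifier n : Verifier (EMVInstance n) EMVInstance.Claim` — certificates = the boxes
  and the centre data (`EMVCertData`), claim = existence plus `φ(h, W) ⊆ final`.
* KERNEL EXAMPLE `pendulumMV`: the pendulum `x₁' = x₂`, `x₂' = −sin x₁` from the BOX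
  `W = [0.99, 1.01] × [−0.01, 0.01]`, `h = 1/8`, `C¹` order `5`, centre `(1, 0)` with the point
  certificate of order `6` = the data of `pendulum` (`ElementaryFieldEnclosureCertificate`):
  `pendulumMV_check` (by `decide`), `pendulumMV_mvEndBox_le`
  (`φ(1/8, W) ⊆ [0.98222, 1.00464] × [−0.11569, −0.09438]`, widths `0.02242`, `0.02131`),
  `pendulumMV_directEndBox_ge` (the direct order-`5` Taylor box of the same step contains
  `[0.9821, 1.0047] × [−0.1165, −0.0936]`, widths `≥ 0.0226`, `0.0229`), `pendulumMV_sound`.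

## Soundness chain

`check` ⇒ (`EVarStepCert.check`) the state certificate `toE` holds on `W`, so every `x' ∈ W`
carries a solution on `[0, h]` staying in `S` (`EStepCert.sound`); choosing one solution per
point and the GIVEN solution `z` at `x` yields an `IsSolutionFamily` through `W`;
`EVarStepCert.hasFDerivWithinAt_flow_step` (needs `posBox S`) gives
`HasFDerivWithinAt (x' ↦ u x' h) J(x') W x'` with `J(x') ∈ J1` entrywise on `W`;
`exists_matrixIcc_meanValue_of_hasFDerivWithinAt` (convex `W`, row-wise mean value theorem)
gives `u x h = u m h + M (x − m)`, `M ∈ [J1]`; `u m h ∈ pointCert.endBox`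
(`EStepCert.mem_endBox`), and `meanValue_mem_mvBoxQ` finishes.

## Honest limits (stated, not hidden)

* On the near-isometric pendulum example the mean value box is only `1 %` / `7 %` narrower than
  the direct box (little dependency in `Φⱼ(W)`); the form pays off on fields with dependency
  (the polynomial file's Volterra example: `3×`) and, above all, as the input of the
  parallelepiped / `QR` hand-over, which is NOT performed here: in a chain of such steps the
  wrapping effect still accumulates in `W`.
* Single step, constant a-priori boxes; acceptance — never soundness — depends on the precision
  parameters `cfg` of the derived program; the symbolic Jacobian code lists grow quickly with the
  order (the example's `C¹` part has order `5`, its point part order `6`).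

## References

* R. E. Moore, *Methods and Applications of Interval Analysis*, SIAM 1979: §4.3 eq. (4.19) (mean
  value extension), remark after (4.25); §8.1 (8.10)–(8.13); §8.2 item 1 (wrapping effect).
  [held: lit key book:moorend-methods-applications-interval-analysis, pp. 43–45, 80–84]
  [Moore1979]
* M. Mrozek, P. Zgliczyński, *Set arithmetic and the enclosing problem in dynamics*, Ann. Polon.
  Math. 74 (2000): Theorem 7.5, §8. [held: lit key paper:doi-10-4064-ap-74-1-237-259, p. 248]
  [MrozekZgliczynski2000]
* A. Neumaier, *Interval Methods for Systems of Equations*, Cambridge UP 1990: Cor. 5.1.5, §3.1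
  Proposition 3.1.2 (6)–(7). [Neumaier1991]
* P. Zgliczyński, *C¹ Lohner algorithm*, Found. Comput. Math. 2 (2002): §3. [Zgliczynski2002C1Lohner]
* I. Walawska, D. Wilczak, Appl. Math. Comput. 291 (2016): §2, §2.1. [held: lit key
  paper:arxiv-1509.07388, p. 5] [WalawskaWilczak2016]
* N. S. Nedialkov, K. R. Jackson, G. F. Corliss, Appl. Math. Comput. 105 (1999), §5 Algorithm
  I / II. [NedialkovJacksonCorliss1999]
* N. S. Nedialkov, K. R. Jackson, J. D. Pryce, Reliable Computing 7 (2001), §3.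
  [NedialkovJacksonPryce2001]
* R. E. Moore, *Interval Analysis*, Prentice-Hall 1966, §4.4. [Moore1966]
-/

noncomputable section

open Set NonemptyInterval Matrix
open Literature.Analysis.ValidatedNumerics Literature.Analysis.ValidatedNumerics.ITaylor

namespace Literature.Analysis.ODE

open FExpr

/-! ### A solution family through a box containing a prescribed solution -/

section Family

variable {n : ℕ}

/-- If every point of `W` carries a solution on `[0, T]` and every solution from `W` stays in
`S`, then any given solution `z` from `x ∈ W` is the member at `x` of some `IsSolutionFamily` on
`W` (one solution chosen per point; no uniqueness needed). [folklore] -/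
private theorem exists_family_with_member {F : (Fin n → ℝ) → Fin n → ℝ}
    {W S : Set (Fin n → ℝ)} {T : ℝ}
    (hex : ∀ x' ∈ W, ∃ y : ℝ → Fin n → ℝ, y 0 = x' ∧
      ∀ t ∈ Icc 0 T, HasDerivWithinAt y (F (y t)) (Icc 0 T) t)
    (henc : ∀ x' ∈ W, ∀ y : ℝ → Fin n → ℝ, y 0 = x' →
      (∀ t ∈ Icc 0 T, HasDerivWithinAt y (F (y t)) (Icc 0 T) t) → ∀ t ∈ Icc 0 T, y t ∈ S)
    {x : Fin n → ℝ} (hx : x ∈ W) {z : ℝ → Fin n → ℝ} (hz0 : z 0 = x)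
    (hz : ∀ t ∈ Icc 0 T, HasDerivWithinAt z (F (z t)) (Icc 0 T) t) :
    ∃ u : (Fin n → ℝ) → ℝ → Fin n → ℝ, u x = z ∧ IsSolutionFamily F S W T u := by
  classical
  choose y hy0 hy using hex
  obtain ⟨u, hu⟩ : ∃ u : (Fin n → ℝ) → ℝ → Fin n → ℝ,
      u = fun x' => if x' = x then z else if h' : x' ∈ W then y x' h' else fun _ => x' :=
    ⟨_, rfl⟩
  have hux : u x = z := by
    rw [hu]
    exact if_pos rfl
  have hun : ∀ x' (h' : x' ∈ W), x' ≠ x → u x' = y x' h' := by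
    intro x' h' hne
    rw [hu]
    exact (if_neg hne).trans (dif_pos h')
  refine ⟨u, hux, ?_, ?_, ?_⟩
  · intro x' hx'
    by_cases hxx : x' = x
    · rw [hxx, hux, hz0]
    · rw [hun x' hx' hxx]
      exact hy0 x' hx'
  · intro x' hx' τ hτ
    by_cases hxx : x' = x
    · rw [hxx, hux]
      exact hz τ hτ
    · rw [hun x' hx' hxx]
      exact hy x' hx' τ hτ
  · intro x' hx' τ hτ
    by_cases hxx : x' = x
    · rw [hxx, hux]
      exact henc x hx z hz0 hz τ hτ
    · rw [hun x' hx' hxx]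
      exact henc x' hx' _ (hy0 x' hx') (hy x' hx') τ hτ

end Family

/-! ### The mean value step certificate for an elementary field -/

section Certificate

variable {n : ℕ}

/-- **Certificate for one mean-value-form (`C¹`, Lohner-type) step** of `y' = f(y)`, `f` a
vector of code lists, from the box `W`: a `C¹` step certificate (`EVarStepCert`: field, order
`K`, step `h`, `W`, a-priori boxes `S ⊇ y([0,h])`, `VV ⊇ V([0,h])`, precision parameters)
together with a rational centre `m ∈ W` and the data of a point Taylor enclosure from `m` (its
order and a-priori box). [cite: Moore1979, §4.3 eq. (4.19)]
[cite: Zgliczynski2002C1Lohner, §3 (C¹-Lohner algorithm: evaluation φ(h,[x]) ⊂ Φ(h,m) + ∂Φ/∂x(h,[x])([x] − m))] -/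
structure EMVStepCert (n : ℕ) extends EVarStepCert n where
  /-- The centre `m` (a rational point of `W`, typically its midpoint). -/
  center : Fin n → ℚ
  /-- The order of the point Taylor enclosure from the centre. -/
  centerOrder : ℕ
  /-- The claimed a-priori enclosure of the solution from the centre over the whole step. -/
  centerApriori : Fin n → Iv

namespace EMVStepCert

variable (c : EMVStepCert n)

/-- The point Taylor certificate from the centre (same code lists, step and precision).
[cite: Moore1979, §8.1 eq. (8.13)] -/
def pointCert : EStepCert n :=
  ⟨c.field, c.centerOrder, c.step, pointBox c.center, c.centerApriori, c.cfg⟩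

/-- **The checker**: the `C¹` step certificate accepts (state and variational HOE tests over the
code lists), the a-priori state box is non-degenerate, the centre lies in `W`, and the point
certificate from the centre accepts. [cite: Moore1979, §4.3 eq. (4.19)]
[cite: WalawskaWilczak2016, §2.1 (C¹ high-order enclosure)] -/
def check : Bool :=
  c.toEVarStepCert.check && posBox c.apriori && boxLE (pointBox c.center) c.init &&
    c.pointCert.check

/-- **The mean value end box** `F_MV(W) = endBox(m) + J1 · (W − m)` for the flow map `φ(h, ·)`
of the elementary field. [cite: Moore1979, §4.3 eq. (4.19)]
[cite: Zgliczynski2002C1Lohner, §3 (C¹-Lohner algorithm: evaluation φ(h,[x]) ⊂ Φ(h,m) + ∂Φ/∂x(h,[x])([x] − m))] -/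
def mvEndBox : Fin n → Iv :=
  mvBoxQ c.pointCert.endBox c.varEndBox c.init c.center

/-- The componentwise intersection of the mean value end box with the direct Taylor end box of
the step (both enclose `φ(h, W)`). [cite: Moore1979, §4.3 (remark after eq. (4.25))] -/
def meetEndBox : Fin n → Iv :=
  meetBox c.mvEndBox c.toE.endBox

variable {c}

/-- What an accepted certificate contains: an accepted `C¹` step certificate, `posBox S`, the
centre test `[m, m] ≤ W` and an accepted point certificate.
[cite: WalawskaWilczak2016, §2.1 (C¹ high-order enclosure)] [cite: Moore1979, §4.3 eq. (4.19) (m ∈ X)] -/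
theorem check_spec (hc : c.check = true) :
    c.toEVarStepCert.check = true ∧ posBox c.apriori = true ∧
      boxLE (pointBox c.center) c.init = true ∧ c.pointCert.check = true := by
  simp only [check, Bool.and_eq_true] at hc
  exact ⟨hc.1.1.1, hc.1.1.2, hc.1.2, hc.2⟩

/-- **Existence**: if the checker accepts, every `x ∈ W` carries a solution of `y' = f(y)` on
`[0, h]`. [cite: Moore1979, §8.1 eq. (8.10)]
[cite: NedialkovJacksonPryce2001, §3 (constant / Taylor a-priori enclosure)] -/
theorem exists_of_check (hc : c.check = true) {x : Fin n → ℝ}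
    (hx : x ∈ boxSet (castBox c.init)) :
    ∃ y : ℝ → Fin n → ℝ, y 0 = x ∧
      ∀ t ∈ Icc 0 (c.step : ℝ),
        HasDerivWithinAt y (fieldFun c.field (y t)) (Icc 0 (c.step : ℝ)) t :=
  (EStepCert.sound (EVarStepCert.check_spec (check_spec hc).1).1 hx).1

/-- **THE MEAN VALUE FORM OF THE FLOW MAP OF AN ELEMENTARY FIELD** (Moore 1979 (4.19) for
`f = φ(h, ·)`; Mrozek–Zgliczyński 2000 Theorem 7.5): if the checker accepts, then for every
`x ∈ W` and every solution `z` of `y' = f(y)` from `x` on `[0, h]` there are a solution `z_c` from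
the centre `m` on `[0, h]` and a real matrix `M` with entries in the certified Jacobian end box
`J1 = varEndBox` such that `z(h) = z_c(h) + M (x − m)`. [cite: Moore1979, §4.3 eq. (4.19)]
[cite: MrozekZgliczynski2000, Theorem 7.5] [cite: Neumaier1991, Cor. 5.1.5] -/
theorem meanValue (hc : c.check = true) {x : Fin n → ℝ} (hx : x ∈ boxSet (castBox c.init))
    {z : ℝ → Fin n → ℝ} (hz0 : z 0 = x)
    (hz : ∀ t ∈ Icc 0 (c.step : ℝ),
      HasDerivWithinAt z (fieldFun c.field (z t)) (Icc 0 (c.step : ℝ)) t) :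
    ∃ zc : ℝ → Fin n → ℝ, (zc 0 = fun l => (c.center l : ℝ)) ∧
      (∀ t ∈ Icc 0 (c.step : ℝ),
        HasDerivWithinAt zc (fieldFun c.field (zc t)) (Icc 0 (c.step : ℝ)) t) ∧
      ∃ M : Matrix (Fin n) (Fin n) ℝ, (∀ i l, M i l ∈ castMat c.varEndBox i l) ∧
        z c.step = zc c.step + M *ᵥ (x - fun l => (c.center l : ℝ)) := by
  obtain ⟨hcV, hpos, hcen, -⟩ := check_spec hc
  have h1 : c.toE.check = true := (EVarStepCert.check_spec hcV).1
  have hcW : (fun l => (c.center l : ℝ)) ∈ boxSet (castBox c.init) := ratVec_mem_of_boxLE hcen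
  have hex : ∀ x' ∈ boxSet (castBox c.init), ∃ y : ℝ → Fin n → ℝ, y 0 = x' ∧
      ∀ t ∈ Icc 0 (c.step : ℝ),
        HasDerivWithinAt y (fieldFun c.field (y t)) (Icc 0 (c.step : ℝ)) t :=
    fun x' hx' => (EStepCert.sound h1 hx').1
  have henc : ∀ x' ∈ boxSet (castBox c.init), ∀ y : ℝ → Fin n → ℝ, y 0 = x' →
      (∀ t ∈ Icc 0 (c.step : ℝ),
        HasDerivWithinAt y (fieldFun c.field (y t)) (Icc 0 (c.step : ℝ)) t) →
      ∀ t ∈ Icc 0 (c.step : ℝ), y t ∈ boxSet (castBox c.apriori) :=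
    fun x' hx' y hy0 hy t ht => ((EStepCert.sound h1 hx').2 y hy0 hy t ht).1
  obtain ⟨u, hux, hu⟩ := exists_family_with_member hex henc hx hz0 hz
  have hF : ∀ x' ∈ boxSet (castBox c.init), ∃ J : (Fin n → ℝ) →L[ℝ] (Fin n → ℝ),
      HasFDerivWithinAt (fun x'' => u x'' c.step) J (boxSet (castBox c.init)) x' ∧
        ∀ i l, J (Pi.single l 1) i ∈ castMat c.varEndBox i l :=
    fun x' hx' => EVarStepCert.hasFDerivWithinAt_flow_step hcV hpos hu hx'
  choose! Jf hJf hJmem using hF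
  have hA : ∀ x' ∈ boxSet (castBox c.init), ∀ i l,
      (fun i l => ((c.varEndBox i l).fst : ℝ)) i l ≤ Jf x' (Pi.single l 1) i ∧
        Jf x' (Pi.single l 1) i ≤ (fun i l => ((c.varEndBox i l).snd : ℝ)) i l :=
    fun x' hx' i l => mem_ratCast_iff.1 (hJmem x' hx' i l)
  obtain ⟨M, hM, hMeq⟩ := exists_matrixIcc_meanValue_of_hasFDerivWithinAt
    (F := fun x'' => u x'' c.step) (convex_boxSet (castBox c.init)) hJf hA hx hcW
  have hM' : ∀ i l,
      ((c.varEndBox i l).fst : ℝ) ≤ M i l ∧ M i l ≤ ((c.varEndBox i l).snd : ℝ) := hM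
  refine ⟨u fun l => (c.center l : ℝ), hu.init _ hcW, hu.hasDerivWithinAt _ hcW, M,
    fun i l => mem_ratCast_iff.2 (hM' i l), ?_⟩
  rw [← hux]
  exact hMeq

/-- **Soundness of the mean value step certificate**: if the checker accepts, every solution `z`
of `y' = f(y)` from any `x ∈ W` on `[0, h]` satisfies `z(h) ∈ mvEndBox = endBox(m) + J1·(W − m)`
(Moore's mean value extension of the flow map) and `z(h) ∈ toE.endBox` (the direct Taylor
enclosure). [cite: Moore1979, §4.3 eq. (4.19)] [cite: MrozekZgliczynski2000, Theorem 7.5]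
[cite: Zgliczynski2002C1Lohner, §3 (C¹-Lohner algorithm: evaluation φ(h,[x]) ⊂ Φ(h,m) + ∂Φ/∂x(h,[x])([x] − m))] -/
theorem sound (hc : c.check = true) {x : Fin n → ℝ} (hx : x ∈ boxSet (castBox c.init))
    {z : ℝ → Fin n → ℝ} (hz0 : z 0 = x)
    (hz : ∀ t ∈ Icc 0 (c.step : ℝ),
      HasDerivWithinAt z (fieldFun c.field (z t)) (Icc 0 (c.step : ℝ)) t) :
    z c.step ∈ boxSet (castBox c.mvEndBox) ∧ z c.step ∈ boxSet (castBox c.toE.endBox) := by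
  obtain ⟨zc, hzc0, hzc, M, hM, hEq⟩ := meanValue hc hx hz0 hz
  refine ⟨?_, EVarStepCert.mem_endBox (check_spec hc).1 hx hz0 hz⟩
  have hp : zc c.step ∈ boxSet (castBox c.pointCert.endBox) :=
    EStepCert.mem_endBox (check_spec hc).2.2.2 (ratVec_mem_pointBox c.center) hzc0 hzc
  rw [hEq]
  exact meanValue_mem_mvBoxQ hp hM hx

/-- Every solution from `W` ends in `meetEndBox = mvEndBox ∩ endBox`.
[cite: Moore1979, §4.3 eq. (4.19) and remark after eq. (4.25)] -/
theorem mem_meetEndBox (hc : c.check = true) {x : Fin n → ℝ}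
    (hx : x ∈ boxSet (castBox c.init)) {z : ℝ → Fin n → ℝ} (hz0 : z 0 = x)
    (hz : ∀ t ∈ Icc 0 (c.step : ℝ),
      HasDerivWithinAt z (fieldFun c.field (z t)) (Icc 0 (c.step : ℝ)) t) :
    z c.step ∈ boxSet (castBox c.meetEndBox) :=
  mem_meetBox (sound hc hx hz0 hz).1 (sound hc hx hz0 hz).2

end EMVStepCert

end Certificate

/-! ### Packaging as a `Verifier` -/

section VerifierPackaging

variable {n : ℕ}

/-- An instance of the one-step enclosure problem for an elementary field: the code lists, the
precision parameters, a step, a box `W` of initial values and a claimed box `final ⊇ φ(h, W)`.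
[cite: WalawskaWilczak2016, §2 (tighter bounds [x_{k+1}] ⊇ φ(t_k + h_k, [x_0]))] -/
structure EMVInstance (n : ℕ) where
  /-- The vector field, one code list per component. -/
  field : Fin n → FExpr n
  /-- Precision parameters of the derived program. -/
  cfg : SeedCfg
  /-- The step size `h`. -/
  step : ℚ
  /-- The box `W` of initial values. -/
  init : Fin n → Iv
  /-- The claimed enclosure of `φ(h, W)`. -/
  final : Fin n → Iv

/-- The claim certified for an instance: from every `x ∈ W` a solution exists on `[0, h]`, and
every solution from `x` ends in `final` at time `h`.
[cite: WalawskaWilczak2016, §2 (tighter bounds [x_{k+1}] ⊇ φ(t_k + h_k, [x_0]))] -/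
def EMVInstance.Claim (I : EMVInstance n) : Prop :=
  ∀ x ∈ boxSet (castBox I.init),
    (∃ y : ℝ → Fin n → ℝ, y 0 = x ∧
      ∀ t ∈ Icc 0 (I.step : ℝ),
        HasDerivWithinAt y (fieldFun I.field (y t)) (Icc 0 (I.step : ℝ)) t) ∧
    ∀ z : ℝ → Fin n → ℝ, z 0 = x →
      (∀ t ∈ Icc 0 (I.step : ℝ),
        HasDerivWithinAt z (fieldFun I.field (z t)) (Icc 0 (I.step : ℝ)) t) →
      z I.step ∈ boxSet (castBox I.final)

/-- The certificate data of the mean value step verifier: order, a-priori boxes, centre data.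
[cite: NedialkovJacksonCorliss1999, §5 Algorithm I] -/
structure EMVCertData (n : ℕ) where
  /-- The order `K` of the Taylor enclosures on `W`. -/
  order : ℕ
  /-- The a-priori state box `S`. -/
  apriori : Fin n → Iv
  /-- The a-priori Jacobian box `VV`. -/
  varApriori : Fin n → Fin n → Iv
  /-- The centre `m`. -/
  center : Fin n → ℚ
  /-- The order of the point enclosure from the centre. -/
  centerOrder : ℕ
  /-- The a-priori box of the solution from the centre. -/
  centerApriori : Fin n → Iv

/-- The instance together with certificate data, as a mean value step certificate.
[cite: NedialkovJacksonCorliss1999, §5 Algorithm I] -/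
def EMVInstance.withData (I : EMVInstance n) (d : EMVCertData n) : EMVStepCert n where
  field := I.field
  order := d.order
  step := I.step
  init := I.init
  apriori := d.apriori
  varApriori := d.varApriori
  cfg := I.cfg
  center := d.center
  centerOrder := d.centerOrder
  centerApriori := d.centerApriori

/-- **The mean value step verifier for elementary fields** in the sense of
`ValidatedNumerics.Verifier`: the checker runs `EMVStepCert.check` and tests `meetEndBox ≤ final`;
soundness is `EMVStepCert.exists_of_check` and `EMVStepCert.mem_meetEndBox`.
[cite: Moore1979, §4.3 eq. (4.19)]
[cite: WalawskaWilczak2016, §2 (tighter bounds [x_{k+1}] ⊇ φ(t_k + h_k, [x_0]))] -/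
def emvStepVerifier (n : ℕ) : Verifier (EMVInstance n) EMVInstance.Claim where
  Cert := EMVCertData n
  check I d := (I.withData d).check && boxLE (I.withData d).meetEndBox I.final
  sound I d h := by
    simp only [Bool.and_eq_true] at h
    intro x hx
    exact ⟨EMVStepCert.exists_of_check (c := I.withData d) h.1 hx, fun z hz0 hz =>
      boxSet_mono (castBox_mono (le_of_boxLE h.2))
        (EMVStepCert.mem_meetEndBox (c := I.withData d) h.1 hx hz0 hz)⟩

end VerifierPackaging

/-! ### The pendulum from a box of initial values, replayed by the kernel -/

section PendulumExample

/-- **The mean value step for the pendulum** `x₁' = x₂`, `x₂' = −sin x₁` from the BOX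
`W = [0.99, 1.01] × [−0.01, 0.01]`, step `h = 1/8`: `C¹` part of order `5` with the a-priori
boxes `S = [0.96, 1.02] × [−0.14, 0.02]` and `VV = ([0.995, 1.0007], [−0.013, 0.138];
[−0.0761, 0.0072], [0.995, 1.0007])` (row-wise) found by the untrusted inflate-and-retest stage;
centre `m = (1, 0)` with the point certificate of order `6` and a-priori box
`[0.98, 1.001] × [−0.11, 0.001]` — the data of `pendulum`; precision parameters
`⟨40, 30, 12, 3, 0⟩` throughout. [cite: Moore1979, §4.3 eq. (4.19)]
[cite: Moore1979, §8.1 eqs. (8.10), (8.13)] -/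
def pendulumMV : EMVStepCert 2 where
  field := pendulumField
  order := 5
  step := 1 / 8
  init := ![⟨(99 / 100, 101 / 100), by decide +kernel⟩, ⟨(-1 / 100, 1 / 100), by decide +kernel⟩]
  apriori := ![⟨(96 / 100, 102 / 100), by decide +kernel⟩,
    ⟨(-14 / 100, 2 / 100), by decide +kernel⟩]
  varApriori :=
    ![![⟨(9950 / 10000, 10007 / 10000), by decide +kernel⟩,
        ⟨(-130 / 10000, 1380 / 10000), by decide +kernel⟩],
      ![⟨(-761 / 10000, 72 / 10000), by decide +kernel⟩,
        ⟨(9950 / 10000, 10007 / 10000), by decide +kernel⟩]]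
  cfg := ⟨40, 30, 12, 3, 0⟩
  center := ![1, 0]
  centerOrder := 6
  centerApriori := ![⟨(98 / 100, 1001 / 1000), by decide +kernel⟩,
    ⟨(-11 / 100, 1 / 1000), by decide +kernel⟩]

set_option maxHeartbeats 0 in -- kernel evaluation of the order-5 symbolic Jacobians, < 1 min
/-- The kernel accepts the mean value step certificate: the `C¹` tests on `W`, `posBox S`,
`m ∈ W` and the point test from the centre all hold in rounded rational interval arithmetic.
[cite: Moore1979, §4.3 eq. (4.19)] [cite: WalawskaWilczak2016, §2.1 (C¹ high-order enclosure)] -/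
theorem pendulumMV_check : pendulumMV.check = true := by
  decide +kernel

set_option maxHeartbeats 0 in -- kernel evaluation of the order-5 symbolic Jacobians, < 1 min
/-- The certified mean value end box is contained in `[0.98222, 1.00464] × [−0.11569, −0.09438]`
(widths `0.02242`, `0.02131`; kernel computation). [cite: Moore1979, §4.3 eq. (4.19)] -/
theorem pendulumMV_mvEndBox_le :
    boxLE pendulumMV.mvEndBox
      ![⟨(98222 / 100000, 100464 / 100000), by decide +kernel⟩,
        ⟨(-11569 / 100000, -9438 / 100000), by decide +kernel⟩] = true := by
  decide +kernel

/-- For comparison, the DIRECT Taylor end box of the same step (order `5` over the whole box `W`)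
contains `[0.9821, 1.0047] × [−0.1165, −0.0936]` (widths `≥ 0.0226`, `0.0229`): on this
near-isometric example the mean value form is narrower by `1 %` and `7 %` only (kernel
computation). [cite: Moore1979, §4.3 (remark after eq. (4.25)) and §8.2 (wrapping effect)] -/
theorem pendulumMV_directEndBox_ge :
    boxLE ![⟨(9821 / 10000, 10047 / 10000), by decide +kernel⟩,
        ⟨(-1165 / 10000, -936 / 10000), by decide +kernel⟩]
      pendulumMV.toE.endBox = true := by
  decide +kernel

/-- **Enclosure of the flow of a box, certified by the kernel**: every solution of the pendulum
starting in `W = [0.99, 1.01] × [−0.01, 0.01]` satisfies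
`x(1/8) ∈ [0.98222, 1.00464] × [−0.11569, −0.09438]`. [cite: Moore1979, §4.3 eq. (4.19)]
[cite: MrozekZgliczynski2000, Theorem 7.5] -/
theorem pendulumMV_sound {x : Fin 2 → ℝ} (hx : x ∈ boxSet (castBox pendulumMV.init))
    {z : ℝ → Fin 2 → ℝ} (hz0 : z 0 = x)
    (hz : ∀ t ∈ Icc (0 : ℝ) (((1 / 8 : ℚ) : ℝ)),
      HasDerivWithinAt z (fieldFun pendulumField (z t)) (Icc (0 : ℝ) ((1 / 8 : ℚ) : ℝ)) t) :
    z ((1 / 8 : ℚ) : ℝ) ∈ boxSet (castBox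
      ![⟨(98222 / 100000, 100464 / 100000), by decide +kernel⟩,
        ⟨(-11569 / 100000, -9438 / 100000), by decide +kernel⟩]) :=
  boxSet_mono (castBox_mono (le_of_boxLE pendulumMV_mvEndBox_le))
    (EMVStepCert.sound pendulumMV_check hx hz0 hz).1

end PendulumExample

end Literature.Analysis.ODE
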